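import Summits.Ventures.QEC.Census.FoldDefs2
import HarnessLib

/-!
# Fold enumeration — definitions, part 3: the subset scan with per-node lookup tables

The kernel pays per recursion step, not per bit operation (measured ≈ 0.5 ms/step).  The include/skip scan of
`FoldDefs` spends almost all of its steps in the last two levels of the subset tree.  Here the last two budget
units are resolved by TABLE LOOKUPS instead: per node, the outside columns are indexed (`NodeTab`: column index,
column, reduced column by position, as packed numerals read with `tab`), a SINGLES table maps a reduced value to
the positions carrying it and a PAIRS table maps `red i ⊕ red j` to the pairs `(i, j)`; both hash by the low `b`
residue modulo a prime slot count and keep ≤ 4 entries per slot.  The tables are built by the kernel and then CHECKED complete for this node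
(`tabOK`), so no builder lemma is needed: soundness (`FoldScanPT`) uses only the checked facts.  `fiberPT`,
`nodeCheckPT`, `nodeCheckModPT` are the drop-in twins of `fiber`, `nodeCheck`, `nodeCheckMod`.
-/

namespace Summit.Ventures.QEC.Census.Fold

open Summit.Ventures.QEC.Census

/-! ## Packed per-node tables -/

/-- Replace field `j` (width `w`) of the packed table `T`, currently `old`, by `new`. -/
def tabSet (T w j old new : ℕ) : ℕ := T ^^^ ((old ^^^ new) <<< (w * j))

/-- Slot width of the per-node tables (bits): 64 codes of 8 bits / 32 codes of 16 bits per slot. -/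
def slotW : ℕ := 512

/-- Push an 8-bit code into slot `slot` (newest lowest; the slot keeps the 64 most recent codes). -/
def push8 (S slot code : ℕ) : ℕ :=
  let old := tab S slotW slot
  tabSet S slotW slot old (((old <<< 8) ||| code) % 2 ^ slotW)

/-- Push a 16-bit code into slot `slot` (the slot keeps the 32 most recent codes). -/
def push16 (S slot code : ℕ) : ℕ :=
  let old := tab S slotW slot
  tabSet S slotW slot old (((old <<< 16) ||| code) % 2 ^ slotW)

/-- Decode the codes of width `w` bits of a slot value, lowest first, stopping at the first empty one. -/
def decodes (w : ℕ) : ℕ → ℕ → List ℕ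
  | 0, _ => []
  | f + 1, v => if v = 0 then [] else v % 2 ^ w :: decodes w f (v / 2 ^ w)

/-- The 8-bit codes of a slot value (`0` = empty). -/
def codes8 (v : ℕ) : List ℕ := decodes 8 64 v

/-- The 16-bit codes of a slot value (`0` = empty). -/
def codes16 (v : ℕ) : List ℕ := decodes 16 32 v

/-- Hash slot of a reduced value: residue modulo the (prime) slot count `b`. -/
def slotOf (b x : ℕ) : ℕ := x % b

/-- Per-node tables over the outside triples `(o, M o, red (M o))` indexed by position `i`:
`OI` (8-bit fields: `o`), `MI`, `RI` (`r`-bit fields: column, reduced column), `S1` (singles: slot of `red` ↦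
codes `i+1`), `S2` (pairs: slot of `red i ⊕ red j` ↦ codes `(i+1) + 256·(j+1)`, `i < j`). -/
structure NodeTab where
  /-- column index by position -/
  OI : ℕ
  /-- column by position -/
  MI : ℕ
  /-- reduced column by position -/
  RI : ℕ
  /-- singles table -/
  S1 : ℕ
  /-- pairs table -/
  S2 : ℕ

/-- Build the index tables and the singles table (positions counted from `i`). -/
def buildTab1 (r b : ℕ) : List (ℕ × ℕ × ℕ) → ℕ → NodeTab → NodeTab
  | [], _, T => T
  | oc :: L, i, T =>
    buildTab1 r b L (i + 1)
      ⟨T.OI ||| (oc.1 <<< (8 * i)), T.MI ||| (oc.2.1 <<< (r * i)), T.RI ||| (oc.2.2 <<< (r * i)),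
        push8 T.S1 (slotOf b oc.2.2) (i + 1), T.S2⟩

/-- Pairs of one position `i` (reduced value `ri`) with the later positions (counted from `j`). -/
def buildPairsRow (b ri i : ℕ) : List (ℕ × ℕ × ℕ) → ℕ → ℕ → ℕ
  | [], _, S => S
  | oc :: L, j, S => buildPairsRow b ri i L (j + 1) (push16 S (slotOf b (ri ^^^ oc.2.2)) ((i + 1) + 256 * (j + 1)))

/-- Build the pairs table (positions counted from `i`). -/
def buildPairs (b : ℕ) : List (ℕ × ℕ × ℕ) → ℕ → ℕ → ℕ
  | [], _, S => S
  | oc :: L, i, S => buildPairs b L (i + 1) (buildPairsRow b oc.2.2 i L (i + 1) S)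

/-- CHECK the index and singles tables against the triples (positions from `i`). -/
def tabOK1 (T : NodeTab) (r b : ℕ) : List (ℕ × ℕ × ℕ) → ℕ → Bool
  | [], _ => true
  | oc :: L, i =>
    (tab T.OI 8 i == oc.1) && (tab T.MI r i == oc.2.1) && (tab T.RI r i == oc.2.2) &&
      (codes8 (tab T.S1 slotW (slotOf b oc.2.2))).elem (i + 1) && tabOK1 T r b L (i + 1)

/-- CHECK one row of the pairs table. -/
def pairsRowOK (T : NodeTab) (b ri i : ℕ) : List (ℕ × ℕ × ℕ) → ℕ → Bool
  | [], _ => true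
  | oc :: L, j => (codes16 (tab T.S2 slotW (slotOf b (ri ^^^ oc.2.2)))).elem ((i + 1) + 256 * (j + 1)) &&
      pairsRowOK T b ri i L (j + 1)

/-- CHECK the pairs table against the triples (positions from `i`). -/
def tabOK2 (T : NodeTab) (b : ℕ) : List (ℕ × ℕ × ℕ) → ℕ → Bool
  | [], _ => true
  | oc :: L, i => pairsRowOK T b oc.2.2 i L (i + 1) && tabOK2 T b L (i + 1)

/-! ## The table-assisted scan -/

/-- A leaf: the residual reduces to `0`, record the listed solutions with the chosen outside set `e`. -/
def leafPT (Pv : Piv) (MP : List ℕ) (v rv : ℕ) (e : List ℕ) : List (List ℕ × ℕ) :=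
  if rv == 0 then (Pv.solutions MP v).map fun x => (e, x) else []

/-- Budget exactly one more column, among positions `≥ i`: singles-table lookup. -/
def look1 (Pv : Piv) (MP : List ℕ) (T : NodeTab) (r b v rv : ℕ) (e : List ℕ) (i : ℕ) : List (List ℕ × ℕ) :=
  (codes8 (tab T.S1 slotW (slotOf b rv))).flatMap fun c =>
    if (c == 0) || !(i + 1 ≤ c) || !(tab T.RI r (c - 1) == rv) then []
    else (Pv.solutions MP (v ^^^ tab T.MI r (c - 1))).map fun x => (tab T.OI 8 (c - 1) :: e, x)

/-- Exactly two more columns, both at positions `≥ i`: pairs-table lookup. -/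
def look2 (Pv : Piv) (MP : List ℕ) (T : NodeTab) (r b v rv : ℕ) (e : List ℕ) (i : ℕ) : List (List ℕ × ℕ) :=
  (codes16 (tab T.S2 slotW (slotOf b rv))).flatMap fun c =>
    let j1 := c % 256 - 1
    let j2 := c / 256 - 1
    if (c % 256 == 0) || (c / 256 == 0) || !(i ≤ j1) || !(tab T.RI r j1 ^^^ tab T.RI r j2 == rv) then []
    else (Pv.solutions MP (v ^^^ tab T.MI r j1 ^^^ tab T.MI r j2)).map fun x => (tab T.OI 8 j2 :: tab T.OI 8 j1 :: e, x)

/-- THE TABLE-ASSISTED SCAN over the outside triples `L` (= the triples from position `i` on), budget `s`,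
running value `v`, its reduction `rv`, chosen columns `e` (reversed): include/skip recursion while the budget is
`≥ 3`, table lookups for the last two units. Same output contract as `scan`. -/
def scanPT (Pv : Piv) (MP : List ℕ) (T : NodeTab) (r b : ℕ) (pr : Bool) :
    List (ℕ × ℕ × ℕ) → ℕ → ℕ → ℕ → List ℕ → ℕ → List (List ℕ × ℕ)
  | _, 0, v, rv, e, _ => leafPT Pv MP v rv e
  | _, 1, v, rv, e, i => leafPT Pv MP v rv e ++ look1 Pv MP T r b v rv e i
  | [], _ + 2, v, rv, e, _ => leafPT Pv MP v rv e
  | oc :: L, 2, v, rv, e, i =>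
    if pr then leafPT Pv MP v rv e ++ (look1 Pv MP T r b v rv e i ++ look2 Pv MP T r b v rv e i)
    else scanPT Pv MP T r b pr L 1 (v ^^^ oc.2.1) (rv ^^^ oc.2.2) (oc.1 :: e) (i + 1) ++ scanPT Pv MP T r b pr L 2 v rv e (i + 1)
  | oc :: L, s + 3, v, rv, e, i =>
    scanPT Pv MP T r b pr L (s + 2) (v ^^^ oc.2.1) (rv ^^^ oc.2.2) (oc.1 :: e) (i + 1) ++ scanPT Pv MP T r b pr L (s + 3) v rv e (i + 1)

/-- The node tables (pairs only when `pr`). -/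
def nodeTabOf (r b : ℕ) (pr : Bool) (Ot : List (ℕ × ℕ × ℕ)) : NodeTab :=
  let T1 := buildTab1 r b Ot 0 ⟨0, 0, 0, 0, 0⟩
  if pr then ⟨T1.OI, T1.MI, T1.RI, T1.S1, buildPairs b Ot 0 0⟩ else T1

/-- The per-node verification: pivot structure, and the tables the budget needs. -/
def fiberPTchk (MP : List ℕ) (Pv : Piv) (T : NodeTab) (r b s : ℕ) (pr : Bool) (Ot : List (ℕ × ℕ × ℕ)) : Bool :=
  pivOK MP Pv && ((s == 0) || tabOK1 T r b Ot 0) && (!pr || tabOK2 T b Ot 0)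

/-- THE FIBRE ENUMERATOR with lookup tables (`b` = slot count, a prime; `up` = use the pairs table): as `fiber`, with `pivOK` always verified (the
reductions are used at every budget); budgets `≤ 1` use the plain `scan` (no tables), larger budgets build and
check the node tables. -/
def fiberPT (G : Geo) (M Mp : ℕ → ℕ) (W b : ℕ) (up : Bool) (P : List ℕ) : Option (List (List ℕ)) :=
  let MP := P.map M
  let Pv := gaussPiv MP
  let s := (W - P.length) / 2
  let h := frhs Mp P
  let Ot := (outsideOf G.ns P).map fun o => (o, M o, Pv.red (M o))
  if s ≤ 1 then
    (if pivOK MP Pv then some ((scan Pv MP Ot s h (Pv.red h) []).map fun ex => mkWord G P ex.1 ex.2) else none)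
  else
    let pr := up && decide (2 ≤ s)
    let T := nodeTabOf G.r b pr Ot
    if fiberPTchk MP Pv T G.r b s pr Ot then
      some ((scanPT Pv MP T G.r b pr Ot s h (Pv.red h) [] 0).map fun ex => mkWord G P ex.1 ex.2)
    else none

/-- The NODE CHECK with the table-assisted enumerator (cf. `nodeCheck`). -/
def nodeCheckPT (G : Geo) (M Mp Mr : ℕ → ℕ) (W b : ℕ) (up : Bool) (k : List ℕ → Bool) (S : List ℕ) : Bool :=
  !(xorIdx Mr S == 0) ||
    (let P := bitsOf G.ns 0 (maskOf S)
     match fiberPT G M Mp W b up P with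
     | none => false
     | some out => out.all (guardP G P k))

/-- Sliced node check with the table-assisted enumerator (cf. `nodeCheckMod`). -/
def nodeCheckModPT (G : Geo) (M Mp Mr : ℕ → ℕ) (W b : ℕ) (up : Bool) (k : List ℕ → Bool) (S : List ℕ) (q res : ℕ)
    : Bool :=
  !(xorIdx Mr S == 0) ||
    (let P := bitsOf G.ns 0 (maskOf S)
     match fiberPT G M Mp W b up P with
     | none => false
     | some out => allMod q res (guardP G P k) out 0)

end Summit.Ventures.QEC.Census.Fold
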